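import Summits.Schanuel.Schanuel.Theorems.RootDecomp1BFiniteOrderRadical05
import Literature.Barriers.Schanuel.NesterenkoModularScopeHolds
import Literature.Barriers.Schanuel.NesterenkoModularScopeMeasureHoldsProofs
import Literature.NumberTheory.Transcendental.NesterenkoEliminationProp411Holds

/-!
# RootDecomp1BFiniteOrderRadical — lens 4, generation 34 «FINITE-ORDER NESTERENKO STOREY» — part 06: the cells HYPOTHESIS-FREE

(lens-4 g34 `FiniteOrderRadical.lean`, sha256 721281aa…4b53; critic VERDICT STATUS L1761 PORT GO LOW: «plug
`nesterenko1996_thm_1_1_holds` / `NesterenkoPhilippon2001_ch3_thm_5_1_holds` / `…prop_4_11_holds` so that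
`LogSizeMeasure 4 24 nesterenkoTriple` becomes a THEOREM and every cell is HYPOTHESIS-FREE in the tree»; port by census-1 gen 16.)

Parts 01–05 carry the lens kernel verbatim with the three registered facts as BY-NAME binders (the check-farm snapshot had
their proof modules unbuilt, VERDICT L1761 fallback (4′)).  This part imports the three tree-PROVED `_holds` modules and
discharges the binders: the measure (31) at Nesterenko's point and the g34 cells become hypothesis-free theorems.  Ten-line
corollaries only; `--supports stmt-Schanuel-24622`; nothing here proves Schanuel; rung 0.
-/

noncomputable section

open Complex

namespace Summit.Schanuel.Schanuel.Theorems.RootDecomp1BFiniteOrderRadical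

open Literature.Barriers.Schanuel (nesterenko1996_thm_1_1_holds NesterenkoPhilippon2001_ch3_thm_5_1_holds)
open Literature.NumberTheory.Transcendental.Nesterenko (NesterenkoPhilippon2001_ch3_prop_4_11_holds)
open Summit.Schanuel.Schanuel.Theorems.RootDecomp1BFedFlagCore (polarDeg)
open Summit.Schanuel.Schanuel.Theorems.RootDecomp1BTameFlagCore (IsTame HasSharpHyperplane)
open Summit.Schanuel.Schanuel.Theorems.RootDecomp1BDefectFloorDefs (TameDefectZeroAt)
open Summit.Schanuel.Schanuel.Theorems.RootDecomp1KHyper.HyperCell (HyperLiouville)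
open Summit.Schanuel.Schanuel.Theorems.RootDecomp1KGeneric (LiouvilleOrder)

/-- **(31) of LNM 1752 Ch. 3 at Nesterenko's point `(q₀, P(q₀), Q(q₀))`, `q₀ = e^{−2π}` — HYPOTHESIS-FREE**: the log-size
measure `LogSizeMeasure 4 24 nesterenkoTriple`, from `logSizeMeasure_nesterenkoTriple_of` with the three tree-PROVED facts
(NP 1996 Thm 1.1, NP 2001 Ch. 3 Thm 5.1, Prop 4.11) plugged in. -/
theorem logSizeMeasure_nesterenkoTriple : LogSizeMeasure 4 24 nesterenkoTriple :=
  logSizeMeasure_nesterenkoTriple_of nesterenko1996_thm_1_1_holds NesterenkoPhilippon2001_ch3_thm_5_1_holds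
    NesterenkoPhilippon2001_ch3_prop_4_11_holds

/-- **X(2) at `(π, ρπ)` for every `ρ` of exponential Liouville order 57 — HYPOTHESIS-FREE** (item 24622's storey-two cell of g34). -/
theorem four_le_polarDeg_pi_holds {ρ : ℝ} (hρ : LiouvilleOrder 57 ρ) :
    ((2 + 2 : ℕ) : Cardinal) ≤ polarDeg ![Real.pi, ρ * Real.pi] :=
  four_le_polarDeg_pi logSizeMeasure_nesterenkoTriple hρ

/-- X(2) at `(ρπ, π)` (the other ordering) for every `ρ` of order 57 — HYPOTHESIS-FREE. -/
theorem four_le_polarDeg_smul_pi_pi_holds {ρ : ℝ} (hρ : LiouvilleOrder 57 ρ) :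
    ((2 + 2 : ℕ) : Cardinal) ≤ polarDeg ![ρ * Real.pi, Real.pi] :=
  four_le_polarDeg_smul_pi_pi logSizeMeasure_nesterenkoTriple hρ

/-- X(2) at `(π, ρπ)` for every HYPER-Liouville `ρ` (critic rule B-R21 (d)) — HYPOTHESIS-FREE. -/
theorem four_le_polarDeg_pi_hyper_holds {ρ : ℝ} (hρ : HyperLiouville ρ) :
    ((2 + 2 : ℕ) : Cardinal) ≤ polarDeg ![Real.pi, ρ * Real.pi] :=
  four_le_polarDeg_pi_hyper logSizeMeasure_nesterenkoTriple hρ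

/-- T0At `(ρπ | π)` (item 32407's step cell at these tuples) for every `ρ` of order 57 — HYPOTHESIS-FREE. -/
theorem tameDefectZeroAt_smul_pi_pi_holds {ρ : ℝ} (hρ : LiouvilleOrder 57 ρ) :
    TameDefectZeroAt 1 ![ρ * Real.pi, Real.pi] :=
  tameDefectZeroAt_smul_pi_pi logSizeMeasure_nesterenkoTriple hρ

/-- The named cell: X(2) at `(π, ρ_T π)`, `ρ_T = towerNumber 58` (order 57, NOT hyper-Liouville) — HYPOTHESIS-FREE. -/
theorem four_le_polarDeg_pi_rhoT_holds : ((2 + 2 : ℕ) : Cardinal) ≤ polarDeg ![Real.pi, rhoT * Real.pi] :=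
  four_le_polarDeg_pi_rhoT logSizeMeasure_nesterenkoTriple

/-- The named cell in X's verbatim body shape: `t(π, ρ_T π, iπ, iρ_T π; exp) ≥ 4` — HYPOTHESIS-FREE. -/
theorem kleinPolarSchanuel_body_two_pi_rhoT_holds :
    ((2 + 2 : ℕ) : Cardinal) ≤ Algebra.trdeg ℚ ↥(IntermediateField.adjoin ℚ
      (Set.range (Fin.append (fun j => ((![Real.pi, rhoT * Real.pi] j : ℝ) : ℂ))
          (fun j => ((![Real.pi, rhoT * Real.pi] j : ℝ) : ℂ) * Complex.I)) ∪
        Set.range (Complex.exp ∘ Fin.append (fun j => ((![Real.pi, rhoT * Real.pi] j : ℝ) : ℂ))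
          (fun j => ((![Real.pi, rhoT * Real.pi] j : ℝ) : ℂ) * Complex.I)))) :=
  kleinPolarSchanuel_body_two_pi_rhoT logSizeMeasure_nesterenkoTriple

/-- **FLAGSHIP, HYPOTHESIS-FREE**: a storey-two cell over `π` with a positive irrational NON-hyper-Liouville second exponent
ratio, linearly independent, tame with a sharp hyperplane, at which X(2) holds. -/
theorem exists_storey_two_cell_pi_finiteOrder_holds :
    ∃ ρ : ℝ, 0 < ρ ∧ Irrational ρ ∧ ¬ HyperLiouville ρ ∧ LinearIndependent ℚ ![Real.pi, ρ * Real.pi] ∧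
      IsTame 2 ![Real.pi, ρ * Real.pi] ∧ HasSharpHyperplane 1 ![Real.pi, ρ * Real.pi] ∧
      ((2 + 2 : ℕ) : Cardinal) ≤ polarDeg ![Real.pi, ρ * Real.pi] :=
  exists_storey_two_cell_pi_finiteOrder logSizeMeasure_nesterenkoTriple

end Summit.Schanuel.Schanuel.Theorems.RootDecomp1BFiniteOrderRadical

end
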